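import Mathlib.GroupTheory.SemidirectProduct
import Mathlib.GroupTheory.Index
import Mathlib.Tactic.Group
import Mathlib.Topology.Algebra.OpenSubgroup
import HarnessLib

/-!
# Root models of [EtTh] §1: subgroups `A ⋊ B` of a semidirect product (plumbing for the χ-twisted model)

Mochizuki, *The étale theta function …*, Publ. RIMS **45** (2009) [EtTh], §1, PRIMS PDF pp. 13–14
[cite: MochizukiEtTh2009, §1 p.13]: the coverings `Π^tp_{Y_N} = Δ^tp_{Y_N} · G_{K_N}`, `Π^tp_{Z_N} = Δ^tp_{Z_N} · G_{J_N}`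
of the root are, in every SEMI-SYNTHETIC model `Π^tp_X := Γ ⋊_φ G` (abc-iut R78 reshape (B): `Γ = F̂₂ ×_Ẑ ℤ`,
`G = G_{ℚ_p}` acting through the cyclotomic character), subgroups of the shape `A ⋊ B` with `A ≤ Γ` stable under
`φ(B)`. Mathlib's `SemidirectProduct` has no such subgroup constructor; this file supplies the generic GROUP-THEORETIC
plumbing, carrier-free (any `N ⋊[φ] G`): the subgroup `twistedProd A B` (membership, monotonicity, NORMALITY criterion —
`A`, `B` normal, `A` stable under all of `φ(G)`, and `B` acting trivially on `N/A` —, image under `rightHom`, intersection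
with `Ker rightHom`, the identification `A ⋊ 1 = inl(A)` and the INDEX TRANSFER `[A' ⋊ 1 : A ⋊ 1] = [A' : A]`), the
homomorphism `leftHom f : N ⋊[φ] G →* M`, `g ↦ f(g.left)` for a `φ`-INVARIANT `f : N →* M` (the model's `Π^tp_X ↠ Z`,
a homomorphism precisely because the twist fixes the degree), its kernel and surjectivity, and openness of `A ⋊ B` when
`g ↦ (g.left, g.right)` is continuous. Consumed by the χ-twisted root model (file map R100: F4/F5). Model plumbing only;
nothing of [EtTh] asserted; no side taken on [IUTchIII] Cor. 3.12.
-/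

namespace Literature.AnabelianGeometry.EtaleTheta.SettingModel.Semidirect

open Function

variable {N G : Type*} [Group N] [Group G] {φ : G →* MulAut N}

/-- **`A ⋊ B ≤ N ⋊_φ G`**: the pairs with `left ∈ A`, `right ∈ B`, for `A` stable under `φ(B)` ("`Π^tp_{Y_N} = Δ^tp_{Y_N} · G_{K_N}`").
[cite: MochizukiEtTh2009, §1 p.13] -/
def twistedProd (A : Subgroup N) (B : Subgroup G) (h : ∀ ⦃b⦄, b ∈ B → ∀ ⦃a⦄, a ∈ A → φ b a ∈ A) :
    Subgroup (N ⋊[φ] G) where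
  carrier := {g | g.left ∈ A ∧ g.right ∈ B}
  mul_mem' := by
    rintro x y ⟨hx1, hx2⟩ ⟨hy1, hy2⟩
    exact ⟨by rw [SemidirectProduct.mul_left]; exact A.mul_mem hx1 (h hx2 hy1),
      by rw [SemidirectProduct.mul_right]; exact B.mul_mem hx2 hy2⟩
  one_mem' := ⟨by rw [SemidirectProduct.one_left]; exact A.one_mem,
    by rw [SemidirectProduct.one_right]; exact B.one_mem⟩
  inv_mem' := by
    rintro x ⟨hx1, hx2⟩
    exact ⟨by rw [SemidirectProduct.inv_left]; exact h (B.inv_mem hx2) (A.inv_mem hx1),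
      by rw [SemidirectProduct.inv_right]; exact B.inv_mem hx2⟩

/-- [cite: MochizukiEtTh2009, §1 p.13] -/
@[simp] theorem mem_twistedProd {A : Subgroup N} {B : Subgroup G} {h : ∀ ⦃b⦄, b ∈ B → ∀ ⦃a⦄, a ∈ A → φ b a ∈ A}
    {g : N ⋊[φ] G} : g ∈ twistedProd A B h ↔ g.left ∈ A ∧ g.right ∈ B := Iff.rfl

/-- The trivial subgroup stabilises everything. [cite: MochizukiEtTh2009, §1 p.13] -/
theorem stable_bot (A : Subgroup N) : ∀ ⦃b : G⦄, b ∈ (⊥ : Subgroup G) → ∀ ⦃a⦄, a ∈ A → φ b a ∈ A := by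
  intro b hb a ha
  rw [Subgroup.mem_bot] at hb
  rw [hb, map_one]
  exact ha

/-- A subgroup stable under all of `φ(G)` is stable under `φ(B)`. [cite: MochizukiEtTh2009, §1 p.13] -/
theorem stable_of_forall {A : Subgroup N} (hA : ∀ g : G, ∀ ⦃a⦄, a ∈ A → φ g a ∈ A) (B : Subgroup G) :
    ∀ ⦃b : G⦄, b ∈ B → ∀ ⦃a⦄, a ∈ A → φ b a ∈ A := fun b _ _ ha => hA b ha

/-- [cite: MochizukiEtTh2009, §1 p.18] -/
theorem twistedProd_mono {A A' : Subgroup N} {B B' : Subgroup G} {h : ∀ ⦃b⦄, b ∈ B → ∀ ⦃a⦄, a ∈ A → φ b a ∈ A}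
    {h' : ∀ ⦃b⦄, b ∈ B' → ∀ ⦃a⦄, a ∈ A' → φ b a ∈ A'} (hA : A ≤ A') (hB : B ≤ B') :
    twistedProd A B h ≤ twistedProd A' B' h' := fun _ hg => ⟨hA hg.1, hB hg.2⟩

/-- [cite: MochizukiEtTh2009, §1 p.14] -/
theorem twistedProd_eq_of_eq {A A' : Subgroup N} {B B' : Subgroup G} (hA : A = A') (hB : B = B')
    {h : ∀ ⦃b⦄, b ∈ B → ∀ ⦃a⦄, a ∈ A → φ b a ∈ A} {h' : ∀ ⦃b⦄, b ∈ B' → ∀ ⦃a⦄, a ∈ A' → φ b a ∈ A'} :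
    twistedProd A B h = twistedProd A' B' h' := by
  subst hA; subst hB; rfl

/-- **Normality criterion**: `A ⋊ B` is normal in `N ⋊_φ G` when `A ⊴ N`, `B ⊴ G`, `A` is stable under ALL of `φ(G)`, and
`B` acts trivially on `N/A` (`n · (φ_b n)⁻¹ ∈ A`). (In the model: `G_{K_N}` fixes `μ_N`, so it acts trivially on
`Γ/Δ^tp_{Y_N}`.) [cite: MochizukiEtTh2009, §1 p.14] -/
theorem twistedProd_normal {A : Subgroup N} {B : Subgroup G} {h : ∀ ⦃b⦄, b ∈ B → ∀ ⦃a⦄, a ∈ A → φ b a ∈ A}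
    [hA : A.Normal] [hB : B.Normal] (hstab : ∀ g : G, ∀ ⦃a⦄, a ∈ A → φ g a ∈ A)
    (htriv : ∀ ⦃b⦄, b ∈ B → ∀ n : N, n * (φ b n)⁻¹ ∈ A) : (twistedProd A B h).Normal := by
  constructor
  rintro x ⟨hx1, hx2⟩ y
  have hb' : y.right * x.right * y.right⁻¹ ∈ B := hB.conj_mem _ hx2 _
  refine ⟨?_, ?_⟩
  · rw [SemidirectProduct.mul_left, SemidirectProduct.mul_left, SemidirectProduct.inv_left,
      SemidirectProduct.mul_right]
    have e : φ (y.right * x.right) (φ y.right⁻¹ y.left⁻¹) = (φ (y.right * x.right * y.right⁻¹) y.left)⁻¹ := by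
      rw [← map_inv]; simp only [map_mul, MulAut.mul_apply]
    have h1 : y.left * φ y.right x.left * y.left⁻¹ ∈ A := hA.conj_mem _ (hstab _ hx1) _
    have h2 : y.left * (φ (y.right * x.right * y.right⁻¹) y.left)⁻¹ ∈ A := htriv hb' y.left
    have e2 : y.left * φ y.right x.left * φ (y.right * x.right) (φ y.right⁻¹ y.left⁻¹) =
        (y.left * φ y.right x.left * y.left⁻¹) * (y.left * (φ (y.right * x.right * y.right⁻¹) y.left)⁻¹) := by
      rw [e]; group
    rw [e2]
    exact A.mul_mem h1 h2
  · rw [SemidirectProduct.mul_right, SemidirectProduct.mul_right, SemidirectProduct.inv_right]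
    exact hb'

/-- The image of `A ⋊ B` under `N ⋊_φ G ↠ G` is `B` ("`Π^tp_{Y_N} ↠ G_{K_N}`"). [cite: MochizukiEtTh2009, §1 p.13] -/
theorem map_rightHom_twistedProd {A : Subgroup N} {B : Subgroup G}
    {h : ∀ ⦃b⦄, b ∈ B → ∀ ⦃a⦄, a ∈ A → φ b a ∈ A} :
    (twistedProd A B h).map (SemidirectProduct.rightHom : N ⋊[φ] G →* G) = B := by
  ext b
  constructor
  · rintro ⟨g, hg, rfl⟩
    exact hg.2
  · intro hb
    exact ⟨SemidirectProduct.inr b, ⟨by rw [SemidirectProduct.left_inr]; exact A.one_mem,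
      by rw [SemidirectProduct.right_inr]; exact hb⟩, SemidirectProduct.rightHom_inr b⟩

/-- `(A ⋊ B) ∩ Ker(N ⋊_φ G ↠ G) = A ⋊ 1` ("`Δ^tp_{Y_N} = Π^tp_{Y_N} ∩ Δ^tp_X`"). [cite: MochizukiEtTh2009, §1 p.13] -/
theorem twistedProd_inf_ker_rightHom {A : Subgroup N} {B : Subgroup G}
    {h : ∀ ⦃b⦄, b ∈ B → ∀ ⦃a⦄, a ∈ A → φ b a ∈ A} :
    twistedProd A B h ⊓ (SemidirectProduct.rightHom : N ⋊[φ] G →* G).ker = twistedProd A ⊥ (stable_bot A) := by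
  ext g
  constructor
  · intro hg
    obtain ⟨hg1, hg2⟩ := Subgroup.mem_inf.mp hg
    have hr : g.right = 1 := by rw [MonoidHom.mem_ker] at hg2; exact hg2
    exact ⟨hg1.1, by rw [hr]; exact (⊥ : Subgroup G).one_mem⟩
  · rintro ⟨hg1, hg2⟩
    have hr : g.right = 1 := by rw [Subgroup.mem_bot] at hg2; exact hg2
    refine Subgroup.mem_inf.mpr ⟨⟨hg1, by rw [hr]; exact B.one_mem⟩, ?_⟩
    rw [MonoidHom.mem_ker]
    exact hr

/-- `A ⋊ 1 = inl(A)`. [cite: MochizukiEtTh2009, §1 p.13] -/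
theorem twistedProd_bot_eq_map_inl (A : Subgroup N) :
    twistedProd A (⊥ : Subgroup G) (stable_bot A) = A.map (SemidirectProduct.inl : N →* N ⋊[φ] G) := by
  ext g
  constructor
  · rintro ⟨h1, h2⟩
    have hr : g.right = 1 := by rw [Subgroup.mem_bot] at h2; exact h2
    refine ⟨g.left, h1, ?_⟩
    rw [← SemidirectProduct.inl_left_mul_inr_right g, hr, map_one, mul_one, SemidirectProduct.left_inl]
  · rintro ⟨a, ha, rfl⟩
    exact ⟨by rw [SemidirectProduct.left_inl]; exact ha,
      by rw [SemidirectProduct.right_inl]; exact (⊥ : Subgroup G).one_mem⟩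

/-- **Index transfer** `[A' ⋊ 1 : A ⋊ 1] = [A' : A]` ("`[Δ^tp_Y : Δ^tp_{Y_N}] = N` computed inside `Γ`").
[cite: MochizukiEtTh2009, §1 p.13] -/
theorem relIndex_twistedProd_bot (φ : G →* MulAut N) (A' A : Subgroup N) :
    (twistedProd A' (⊥ : Subgroup G) (stable_bot (φ := φ) A')).relIndex
        (twistedProd A (⊥ : Subgroup G) (stable_bot (φ := φ) A)) = A'.relIndex A := by
  rw [twistedProd_bot_eq_map_inl (φ := φ) A', twistedProd_bot_eq_map_inl (φ := φ) A]
  have h2 := Subgroup.relIndex_comap (A'.map (SemidirectProduct.inl : N →* N ⋊[φ] G))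
    (SemidirectProduct.inl : N →* N ⋊[φ] G) A
  rw [Subgroup.comap_map_eq_self_of_injective SemidirectProduct.inl_injective] at h2
  exact h2.symm

section leftHom

variable {M : Type*} [Group M]

/-- **`g ↦ f(g.left)`** is a homomorphism `N ⋊_φ G →* M` when `f` is `φ`-invariant (the model's `Π^tp_X ↠ Z`: the twist
fixes the degree). [cite: MochizukiEtTh2009, §1 p.12] -/
def leftHom (f : N →* M) (hf : ∀ (g : G) (n : N), f (φ g n) = f n) : N ⋊[φ] G →* M where
  toFun g := f g.left
  map_one' := by rw [SemidirectProduct.one_left, map_one]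
  map_mul' x y := by rw [SemidirectProduct.mul_left, map_mul, hf]

/-- [cite: MochizukiEtTh2009, §1 p.12] -/
theorem leftHom_apply (f : N →* M) (hf : ∀ (g : G) (n : N), f (φ g n) = f n) (g : N ⋊[φ] G) :
    leftHom f hf g = f g.left := rfl

/-- The kernel of a `φ`-invariant `f` is stable under `φ(B)` for every `B`. [cite: MochizukiEtTh2009, §1 p.12] -/
theorem stable_ker (f : N →* M) (hf : ∀ (g : G) (n : N), f (φ g n) = f n) (B : Subgroup G) :
    ∀ ⦃b : G⦄, b ∈ B → ∀ ⦃a⦄, a ∈ f.ker → φ b a ∈ f.ker := by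
  intro b _ a ha
  rw [MonoidHom.mem_ker] at ha ⊢
  rw [hf, ha]

/-- `Ker(leftHom f) = Ker f ⋊ G` ("`Π^tp_Y = Ker(Π^tp_X ↠ Z)`"). [cite: MochizukiEtTh2009, §1 p.12] -/
theorem ker_leftHom (f : N →* M) (hf : ∀ (g : G) (n : N), f (φ g n) = f n) :
    (leftHom f hf).ker = twistedProd f.ker ⊤ (stable_ker f hf ⊤) := by
  ext g
  rw [MonoidHom.mem_ker, mem_twistedProd, MonoidHom.mem_ker, leftHom_apply]
  exact ⟨fun h => ⟨h, Subgroup.mem_top _⟩, fun h => h.1⟩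

/-- [cite: MochizukiEtTh2009, §1 p.12] -/
theorem leftHom_surjective (f : N →* M) (hf : ∀ (g : G) (n : N), f (φ g n) = f n) (hs : Surjective f) :
    Surjective (leftHom f hf) := fun m => by
  obtain ⟨n, hn⟩ := hs m
  exact ⟨SemidirectProduct.inl n, by rw [leftHom_apply, SemidirectProduct.left_inl, hn]⟩

/-- `leftHom f` restricted to `Ker(N ⋊_φ G ↠ G) = inl(N)` is onto when `f` is ("`Δ^tp_X ↠ Z` surjective").
[cite: MochizukiEtTh2009, §1 p.12] -/
theorem leftHom_restrict_ker_rightHom_surjective (f : N →* M) (hf : ∀ (g : G) (n : N), f (φ g n) = f n)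
    (hs : Surjective f) :
    Surjective ((leftHom f hf).restrict (SemidirectProduct.rightHom : N ⋊[φ] G →* G).ker) := fun m => by
  obtain ⟨n, hn⟩ := hs m
  refine ⟨⟨SemidirectProduct.inl n, ?_⟩, ?_⟩
  · rw [MonoidHom.mem_ker, SemidirectProduct.rightHom_inl]
  · rw [MonoidHom.restrict_apply, leftHom_apply]
    show f (SemidirectProduct.inl n : N ⋊[φ] G).left = m
    rw [SemidirectProduct.left_inl, hn]

end leftHom

/-- **Openness**: `A ⋊ B` is open when `A`, `B` are and `g ↦ (g.left, g.right)` is continuous (the model topologises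
`Γ ⋊ G` through this bijection). [cite: MochizukiEtTh2009, §1 p.13] -/
theorem isOpen_twistedProd [TopologicalSpace N] [TopologicalSpace G] [TopologicalSpace (N ⋊[φ] G)]
    (hc : Continuous fun g : N ⋊[φ] G => (g.left, g.right)) {A : Subgroup N} {B : Subgroup G}
    {h : ∀ ⦃b⦄, b ∈ B → ∀ ⦃a⦄, a ∈ A → φ b a ∈ A} (hA : IsOpen (A : Set N)) (hB : IsOpen (B : Set G)) :
    IsOpen (twistedProd A B h : Set (N ⋊[φ] G)) := by
  have e : (twistedProd A B h : Set (N ⋊[φ] G)) = (fun g : N ⋊[φ] G => (g.left, g.right)) ⁻¹' ((A : Set N) ×ˢ (B : Set G)) := by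
    ext g
    simp only [SetLike.mem_coe, mem_twistedProd, Set.mem_preimage, Set.mem_prod]
  rw [e]
  exact (hA.prod hB).preimage hc

end Literature.AnabelianGeometry.EtaleTheta.SettingModel.Semidirect
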